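import Summits.AtomisticToContinuum.HydrodynamicLimit.Theorems.RelayRaceLocalityLightConeInLawSVCLine
import Summits.AtomisticToContinuum.HydrodynamicLimit.Theorems.RelayRaceLocalityLightConeInLawStubTimeZero

/-!
# Crux `LightConeInLaw` (stmt-AtomisticToContinuum-12500), line `susceptibility-variance-continuity`
— rung `cone_time_zero` (the TIME-ZERO slice of the stub `stub_cone`)

Support file (`--supports stmt-AtomisticToContinuum-12500`) proving the registered helper stub
`cone_time_zero` of the line `susceptibility-variance-continuity` (skeleton
`Cruxes/LightConeInLaw/Lines/susceptibility_variance_continuity.lean`, route `RelayRaceLocality`):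
the commensurate two-copy light cone in law `stub_cone` (gas 1: `N + 1` spheres of diameter
`hsDiameter σ₁ N`, local Gibbs law of profile `(a₁, u₁, θ₁)`; gas 2: `n₂ N = ⌈(σ₂/σ₁)³ (N+1)⌉₊`
spheres of the SAME diameter, canonical law of profile `(a₂, u₂, θ₂)`; both with laws of large
numbers at `t = 0` towards classical hard-sphere Euler data agreeing in reduced units on the ball
`B(x₀, R)`), VERBATIM, with the single extra hypothesis `t = 0`.

## Proof

A direct instantiation of the landed general time-zero merging theorem
`LightConeInLawSketch.TimeZero.stub_timeZero` (file
`Theorems/RelayRaceLocalityLightConeInLawStubTimeZero.lean`): take `n₁ N = N + 1`,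
`ε₁ N = ε₂ N = hsDiameter σ₁ N`, the crux's `n₂`, the two `let`-bound laws `P₁`, `P₂`, and the
time-`0` fields `(ρᵢ 0, Uᵢ 0, Θᵢ 0)`. The crux hypothesis `TendstoHydroFieldsAt P₁ Φ₁ ρ₁ U₁ Θ₁ 0`
IS `LLNAt (fun N => N + 1) P₁ Φ₁ (ρ₁ 0) (U₁ 0) (Θ₁ 0) 0` (`tendstoHydroFieldsAt_iff_LLNAt`,
`Iff.rfl`), the inline triple of limits for gas 2 IS `LLNAt n₂ P₂ Φ₂ (ρ₂ 0) (U₂ 0) (Θ₂ 0) 0`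
(definitionally), the agreement clause is literally the one of `stub_timeZero`, and after
substituting `t = 0` the support clause `R - c * 0 ≤ dist → χ = 0` is `R ≤ dist → χ = 0`
(`mul_zero`, `sub_zero`). The free constants are chosen as `η₀ := 1`, `c := 1`, `σ₀ := 1`; the
Euler-solution, guard, continuity and positivity hypotheses are not used.

References: H. Spohn, *Large Scale Dynamics of Interacting Particles* (1991), Part I Ch. 3 (local
Gibbs states and their laws of large numbers); the merging step is the elementary bounded-Lipschitz
argument of `stub_timeZero`.
-/

namespace Summit.AtomisticToContinuum.HydrodynamicLimit.Theorems.LightConeInLawSVC.ConeTimeZero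

open scoped BigOperators Topology Classical ENNReal
open Filter Set MeasureTheory
open Literature.MathematicalPhysics.KineticTheory Literature.Analysis.FluidPDE
open Summit.AtomisticToContinuum.HydrodynamicLimit.Theorems.LightConeInLawSketch
open Summit.AtomisticToContinuum.HydrodynamicLimit.Theorems.LightConeInLawSVC

noncomputable section

/-- **Rung `cone_time_zero`: the slice `t = 0` of the commensurate two-copy light cone in law
`stub_cone`.** For the two gases of the crux (gas 1: `N + 1` spheres, local Gibbs law of profile
`(a₁, u₁, θ₁)`; gas 2: `n₂ N = ⌈(σ₂/σ₁)³ (N+1)⌉₊` spheres, canonical law of profile `(a₂, u₂, θ₂)`;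
common diameter `hsDiameter σ₁ N`) whose time-`0` empirical fields satisfy laws of large numbers
towards Euler data agreeing in reduced units on `B(x₀, R)`, the expectations of every bounded
`1`-Lipschitz functional of the reduced empirical fields at time `t = 0`, tested against a
continuous `χ` vanishing off `B(x₀, R - c t) = B(x₀, R)`, are asymptotically equal. Corollary of
`LightConeInLawSketch.TimeZero.stub_timeZero`. -/
theorem cone_time_zero :
    ∃ η₀ : ℝ, 0 < η₀ ∧ ∀ M : ℝ, 0 < M → ∃ c : ℝ, 0 < c ∧ ∀ (a₁ θ₁ a₂ θ₂ : T3 → ℝ) (u₁ u₂ : T3 → V3),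
    Continuous a₁ → Continuous θ₁ → Continuous u₁ → Continuous a₂ → Continuous θ₂ → Continuous u₂ →
    (∀ x, 0 < a₁ x) → (∀ x, 0 < θ₁ x) → (∀ x, 0 < a₂ x) → (∀ x, 0 < θ₂ x) → ∃ σ₀ : ℝ, 0 < σ₀ ∧ ∀
    (σ₁ σ₂ : ℝ), 0 < σ₁ → σ₁ < σ₀ → 0 < σ₂ → σ₂ < σ₀ → ∀ n₂ : ℕ → ℕ, (∀ N, n₂ N = ⌈(σ₂ / σ₁) ^ 3 *
    ((N + 1 : ℕ) : ℝ)⌉₊) → ∀ (T₁ T₂ : ℝ) (ρ₁ Θ₁ ρ₂ Θ₂ : ℝ → T3 → ℝ) (U₁ U₂ : ℝ → T3 → V3),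
    IsHardSphereEulerSolution σ₁ T₁ ρ₁ U₁ Θ₁ → IsHardSphereEulerSolution σ₂ T₂ ρ₂ U₂ Θ₂ → ∀ (Φ₁ :
    (N : ℕ) → HardSphereFlow (Torus.geometry (Fin 3)) (hsDiameter σ₁ N) (N + 1)) (Φ₂ : (N : ℕ) →
    HardSphereFlow (Torus.geometry (Fin 3)) (hsDiameter σ₁ N) (n₂ N)),
    let P₁ : (N : ℕ) → Measure (Config (N + 1) (Fin 3) T3) := fun N => localGibbsLaw σ₁ a₁ u₁ θ₁ N (Φ₁ N);
    let P₂ : (N : ℕ) → Measure (Config (n₂ N) (Fin 3) T3) := fun N => particleLaw (Φ₂ N) (canonicalDensity (Torus.geometry (Fin 3)) (hsDiameter σ₁ N) (n₂ N) (localGibbsProfile a₂ u₂ θ₂));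
    (∀ N, IsProbabilityMeasure (P₁ N)) → (∀ N, IsProbabilityMeasure (P₂ N)) → TendstoHydroFieldsAt
    P₁ Φ₁ ρ₁ U₁ Θ₁ 0 → (∀ χ : T3 → ℝ, Continuous χ → ∀ δ : ℝ, 0 < δ → Tendsto (fun N => P₂ N {z | δ
    < |empiricalDensityField ((Φ₂ N).flow 0 z) χ - ∫ x, χ x * ρ₂ 0 x|}) atTop (nhds 0) ∧ Tendsto
    (fun N => P₂ N {z | δ < ‖empiricalMomentumField ((Φ₂ N).flow 0 z) χ - ∫ x, (χ x * ρ₂ 0 x) • U₂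
    0 x‖}) atTop (nhds 0) ∧ Tendsto (fun N => P₂ N {z | δ < |empiricalEnergyField ((Φ₂ N).flow 0 z)
    χ - ∫ x, χ x * totalEnergyDensity (ρ₂ 0 x) (U₂ 0 x) (Θ₂ 0 x)|}) atTop (nhds 0)) → ∀ t : ℝ, 0 ≤
    t → t < T₁ → t < T₂ → t = 0 → (∀ s ∈ Set.Icc 0 t, ∀ x, ρ₁ s x * σ₁ ^ 3 < η₀ ∧ Θ₁ s x ≤ M ∧ ‖U₁ s x‖ ≤ M
    ∧ ρ₂ s x * σ₂ ^ 3 < η₀ ∧ Θ₂ s x ≤ M ∧ ‖U₂ s x‖ ≤ M) → ∀ (x₀ : T3) (R : ℝ), (∀ x,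
    Torus.euclidDist x x₀ < R → ρ₁ 0 x * σ₁ ^ 3 = ρ₂ 0 x * σ₂ ^ 3 ∧ U₁ 0 x = U₂ 0 x ∧ Θ₁ 0 x = Θ₂ 0
    x) → ∀ χ : T3 → ℝ, Continuous χ → (∀ x, R - c * t ≤ Torus.euclidDist x x₀ → χ x = 0) → ∀ F : ℝ
    × V3 × ℝ → ℝ, LipschitzWith 1 F → (∀ p, |F p| ≤ 1) → Tendsto (fun N => (∫ z, F (σ₁ ^ 3 *
    empiricalDensityField ((Φ₁ N).flow t z) χ, (σ₁ ^ 3) • empiricalMomentumField ((Φ₁ N).flow t z)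
    χ, σ₁ ^ 3 * empiricalEnergyField ((Φ₁ N).flow t z) χ) ∂(P₁ N)) - ∫ z, F (σ₂ ^ 3 *
    empiricalDensityField ((Φ₂ N).flow t z) χ, (σ₂ ^ 3) • empiricalMomentumField ((Φ₂ N).flow t z)
    χ, σ₂ ^ 3 * empiricalEnergyField ((Φ₂ N).flow t z) χ) ∂(P₂ N)) atTop (nhds 0) := by
  refine ⟨1, one_pos, fun M _hM => ⟨1, one_pos, ?_⟩⟩
  intro a₁ θ₁ a₂ θ₂ u₁ u₂ _ha₁ _hθ₁ _hu₁ _ha₂ _hθ₂ _hu₂ _ha₁0 _hθ₁0 _ha₂0 _hθ₂0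
  refine ⟨1, one_pos, ?_⟩
  intro σ₁ σ₂ hσ₁ _hσ₁' hσ₂ _hσ₂' n₂ _hn₂ T₁ T₂ ρ₁ Θ₁ ρ₂ Θ₂ U₁ U₂ _hsol₁ _hsol₂ Φ₁ Φ₂ P₁ P₂ hP₁ hP₂
    hL₁ hL₂ t _ht _htT₁ _htT₂ ht0 _hguard x₀ R hagree χ hχ hsupp F hF hFb
  subst ht0
  -- the crux's `TendstoHydroFieldsAt` at time `0` IS the law of large numbers `LLNAt` of gas 1
  have hL₁' : LLNAt (fun N => N + 1) P₁ Φ₁ (ρ₁ 0) (U₁ 0) (Θ₁ 0) 0 :=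
    (tendstoHydroFieldsAt_iff_LLNAt P₁ Φ₁ ρ₁ U₁ Θ₁ 0).1 hL₁
  -- the inline triple of limits IS the law of large numbers `LLNAt` of gas 2
  have hL₂' : LLNAt n₂ P₂ Φ₂ (ρ₂ 0) (U₂ 0) (Θ₂ 0) 0 := hL₂
  -- at `t = 0` the shrunken ball `B(x₀, R - c t)` is `B(x₀, R)`
  have hsupp' : ∀ x, R ≤ Torus.euclidDist x x₀ → χ x = 0 := fun x hx =>
    hsupp x (by rw [mul_zero, sub_zero]; exact hx)
  exact TimeZero.stub_timeZero (fun N => N + 1) n₂ (fun N => hsDiameter σ₁ N)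
    (fun N => hsDiameter σ₁ N) σ₁ σ₂ hσ₁ hσ₂ Φ₁ Φ₂ P₁ P₂ hP₁ hP₂ (ρ₁ 0) (Θ₁ 0) (ρ₂ 0) (Θ₂ 0)
    (U₁ 0) (U₂ 0) hL₁' hL₂' x₀ R hagree χ hχ hsupp' F hF hFb

end

end Summit.AtomisticToContinuum.HydrodynamicLimit.Theorems.LightConeInLawSVC.ConeTimeZero
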